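import Literature.MathematicalPhysics.QuantumFieldTheory.Balaban1983to89.B8Prop3GaugeFixedKLevel

/-!
# `Balaban1983to89.B8Thm2GaugeFixedKLevel` — [Balaban1985RegularSpaces] THEOREM 2 (p. 83), EXISTENCE HALF, AT OBJECTS ON THE CONCRETE `ℤᵈ`
# CARRIERS, MODULO SOCKETS: the four remaining members of Proposition 3's conclusion ((1.36)₂ `|∇^η_{U₀}A′|`, (1.36)₃ the Hölder member,
# (1.39) `|D^{η*}D^ηA′|`, `|Δ^ηA′|`) for the FINAL level-`k` gauge-fixed field of Theorem 4's induction, and the corollary «∃ u unitary with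
# (1.29)_k, Lan k W, (1.36)₁₋₃, (1.39)» — p. 88: «Of course this theorem implies Theorem 2»

statement-level skeleton of published theorems with citation tags; proofs where landed; nothing here is a claim about the
Yang–Mills mass gap

T. Bałaban, *Spaces of regular gauge field configurations on a lattice and gauge fixing conditions*, Commun. Math. Phys. **99**
(1985) 75–102 `[Balaban1985RegularSpaces]` ("B8"; printed page = PDF page + 74), Theorem 2 p. 83, Proposition 3 p. 87 with (1.62),
Theorem 4 p. 88 («Of course this theorem implies Theorem 2»), (1.36)–(1.39) p. 82, (1.59)–(1.62) pp. 86–87; [4] =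
[Balaban1985BackgroundPropagators] Theorem 3.3 (the (1.59) in-edge b9).  STATUS: published, refereed.

CITATION HEADER (lean-in-tree rule).  Cell `pub-ymgap` (YM Track A, DAG node N05 = [B8], HUMAN RULING D-0062), seat `pub-ymgap-dag-n11-b`
(gen 3) acting as a FREE HAND on the OWNER'S CUT of the N05 knit seat `pub-ymgap-dag-n05-a` g4 ([DAGN05A-G4-CUT-2] pub-ymgap INBOX
2026-08-26T03:03Z, routed by dag-lead [REBALANCE-39]).  WHAT IS REPRODUCED = the p. 88 sentence «Of course this theorem implies Theorem 2»
at objects: n04-b's `B8Prop3GaugeFixedKLevel.thm4_exists_all_levels_of_b9` (p417654 §5) delivers, for the gauge-fixed field `(u, W, A)` of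
Theorem 4's induction at EVERY level `m ≤ k`, only the FIRST member of (1.36) (`‖A_b‖ ≤ c⋆(Lʲη)⁻¹`, `c⋆ = 5dLB₀(α₀ + α₁)` — all the
induction needs); Theorem 2 = Theorem 4 + Proposition 3 wants ALL of (1.36) and (1.39) for the FINAL level-`k` field.  Here n05-b's
Proposition 3 at `k` levels (`B8Prop3KLevel.prop3_norms_kLevel`, M3 p411479 — all four members — and `prop3_fifth_kLevel`, the Hölder member)
is applied ONCE MORE to that final field, with the RESET constant `α₂ := c⋆` in (1.41) (the final field already carries it).  Kind
«kernel-checked proof», theorems only: no `def`, no `… : Prop` fact, no existing module modified.  ENGINE BY NAME: `prop3_norms_kLevel`,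
`prop3_fifth_kLevel` (n05-b); `logField_spec`, `mem_unitaryUnits_of_mgauge_eq`, `mulCfg_eq_gaugeAct_of_mgauge_eq`, `inAk_congr_of_sideTouches`,
`expCfg_iEta_eq_cfgExp`, `cfgExp_congr_at`, `thm4_exists_all_levels_of_b9` (n04-b); `B8Ineq132.inAk_gaugeAct_iff`, `norm_conjR`;
`B8ScaledSupNorm.{bdd_of_forall, weight_mul_norm_le_msup, norm_le_of_msup_le, weight_neg_natCast, msup_nonneg, scale_pos}`.

## THE PRINTED TEXT

p. 83 [PDF 9]: «Theorem 2. There exist constants B₁, B₂(β₀), c₁ such that for arbitrary U₀, U′U₀ satisfying (1.33)–(1.35) with α₀ + α₁ ≦ c₁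
there exists exactly one gauge transformation u satisfying (1.29) and such that the conditions (1.36)–(1.39) hold for the configuration
U₁ = U′^{u⁻¹}.»  p. 82 [PDF 8]: «U₁ = exp iηA, |A| < B₁(α₀+α₁)(Lʲη)⁻¹, |∇^η_{U₀}A| < B₁(α₀+α₁)(Lʲη)⁻², ‖A‖_{1,β} < B₂(β)(α₀+α₁)(Lʲη)^{−2−β}
on Ω_j, (1.36) … |D^{η*}_{U₀}D^η_{U₀}A|, |Δ^η_{U₀}A| < B₁(α₀ + α₁)(Lʲη)⁻³ on Ω_j (1.39)».  p. 87 [PDF 13]: «Proposition 3. If U₀, U₁U₀ satisfy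
(1.40)–(1.42) … then U₁ satisfies (1.36)–(1.39) with B₁ = 5dLB₀, B₂(β₀) = 5dLB₀(β₀)».  p. 88 [PDF 14]: «Theorem 4. … Of course this theorem
implies Theorem 2.»

## WHAT IS CERTIFIED HERE (kernel; axioms `propext` ∕ `Classical.choice` ∕ `Quot.sound`)

* §1 **`exists_maskedLogField`** — the exponent field of a delivered gauge-fixed field (n04-b's §4 construction as a standalone theorem):
  for `W` unitary-valued with `W_b = e^{iηA_b}`, `‖A_b‖ ≤ c⋆(Lʲη)⁻¹` on `E j = SideTouches (Ω j)`, `j ≤ k`, `16c⋆ ≤ 1`, there is `A′` —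
  `(1/iη) log W` masked to `⋃_{j ≤ k} E j` — SELF-ADJOINT EVERYWHERE, `= A` and with `W = e^{iηA′}` on the `E j`, `= 0` off them.
* §2 **`thm2_norms_gaugeFixed_kLevel`** — PROPOSITION 3 FOR THE FINAL LEVEL-`k` GAUGE-FIXED FIELD, ALL MEMBERS: for `(u, W, A′)` with `u`
  unitary-valued, `W^{u} = U′`, (1.29) `Restr129 L k (Λs k) U₀ u`, `Lan k W` (`Lan` ARBITRARY), `A′` as in §1 at the constant `c⋆`:
  `|A′|₍₋₁₎, |∇^η_{U₀}A′|₍₋₂₎, |D^{η*}D^ηA′|₍₋₃₎, Lp A′ ≤ 5dLB₀(α₀ + α₁)` and `Hol A′ ≤ 5dL·B₀β·(α₀ + α₁)` — `prop3_norms_kLevel` ∕ `prop3_fifth_kLevel`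
  at `α₂ := c⋆` with (1.40)₀ = (1.33) `h33`, (1.40)₁ = (1.34) `h34` transported to `e^{iηA′}U₀` by gauge invariance + locality (as in n04-b's
  §4), (1.41) = the c⋆-socket, MODULO `H59full` (the (1.59) in-edge b9 = [4] Thm 3.3: ONE outer ∀-hypothesis per `(u, W, A′)`, guarded by
  `Lan k W` ∕ `Restr129` ∕ `mgauge` ∕ self-adjointness ∕ the c⋆-socket ∕ the mask, delivering the a-, g-, j-, l- and h-lines) and `H42`
  (the (1.42) clause, n04-b's shape at the c⋆ guard); pointwise form `thm2_pointwise_A` (print's (1.36)₁ «on Ω_j»; (1.36)₂ pointwise = `B8Prop3KLevel.prop3_pointwise_grad_kLevel`).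
* §3 **`thm2_exists_gaugeFixed_kLevel`** — THE COROLLARY (p. 88 «Of course this theorem implies Theorem 2», existence half, at objects,
  modulo sockets): `thm4_exists_all_levels_of_b9 … k le_rfl` ∘ §1 ∘ §2 — «∃ u unitary-valued, (1.29)_k ∧ (1 ≤ k → Lan k W) for the
  gauge-fixed `W`, ∧ ∃ A′ self-adjoint with `W = e^{iηA′}` on the `E j` and the five norm bounds» — modulo Theorem 4's sockets
  (`hP5base`∕`hP5`, `H42`∕`H59` at the `2Lc⋆ + 8α₄` guard) AND this file's `H42⋆`∕`H59full` (c⋆ guard), with both window sets.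

## DESIGN POINT (owner's amendment [DAGN05A-G4-WORD-39]): (1.39)₁ `|D^{η*}_{U₀}D^η_{U₀}A′|₍₋₃₎` is the CONCRETE k-level sup-norm
`B8ScaledSupNorm.bondNorm L k η (−3) Ω (pdiv η U₀ (plaqCovDeriv η U₀ A′))` (`B8Eq143PlaqExpansion.pdiv` ∘ `B8Eq146AExpansion.plaqCovDeriv` —
the third member of `B8Prop7AdmittedFamily`'s `C140`); (1.39)₂ `|Δ^η_{U₀}A′|` (Δ = D*D + DD* on vector fields — no k-level decl in the tree)
and the Hölder member (1.36)₃ are ABSTRACT k-level functionals `Lp Hol : (Site d → Fin d → 𝔸) → ℝ` tied to `A′` ONLY through their (1.59)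
lines inside `H59full` — exactly `prop3_norms_kLevel`'s treatment of `l` and `prop3_fifth_kLevel`'s of `h` («no k-level Hölder seminorm object is
modelled here»); (1.39)₂ and (1.36)₃ are thus delivered for ANY functional obeying the [B9] Thm 3.3 line (objects = pin ∕ definition lane);
the first two members ARE the concrete weighted suprema `B8ScaledSupNorm.msup` over `SideTouches (Ω j)` (exponents `−1`, `−2`), as in n04-b's §4.

## HONEST SCOPE — what is NOT claimed

(i) Propositions 3 and 5, Theorem 4's induction, the (1.59) in-edge and the (1.42) clause are NOT re-proved (by name ∕ hypotheses).  (ii) The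
uniqueness half of Theorem 2 is not touched (`B8Thm4UniqueLocal`, `B8Thm2AtConstants.thm2UniqueAt_of_bodies`).  (iii) `E j = SideTouches (Ω j)`
(located reading G-B8-16) for hypothesis and conclusion; windows = `prop3_norms_kLevel`'s at `α₂ = c⋆` (explicit, merely sufficient) on top of
Theorem 4's at `α₂ = 2Lc⋆ + 8α₄`; `d ≥ 2`, `L ≥ 2`, `𝔸` a C⋆-algebra, `U₀`, `U′` unitary-valued; `T_η ↦ ℤᵈ`; `≤` for print's `<`.  Nothing
here discharges N05; count-neutral; one finite T⁴ programme at fixed ε elsewhere; nothing continuum ∕ ℝ⁴ ∕ OS ∕ mass-gap ∕ Clay.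
-/

noncomputable section

open NormedSpace

namespace Literature.MathematicalPhysics.QuantumFieldTheory.Balaban1983to89.B8Thm2GaugeFixedKLevel

open Complex (I I_ne_zero)
open MatrixLog B7Prop1Explicit B7Prop2Explicit B7Prop1Local B7Eq92Concrete
open B8Lemma1NonAbelian (mulCfg)
open B8Ineq132 (covDerivFwd covDeriv covDiv plaqF InAk CondAt BondTouches PlaqTouches)
open B8Eq140Level (SideTouches)
open B8Eq119TwistedAxial (Restr129)
open B8Eq184Proof (gaugeExp cfgExp)
open B8Eq146AExpansion (iEta expCfg plaqCovDeriv)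
open B8Eq143PlaqExpansion (pdiv)
open B7Prop4GeneralLevels (logCovIter linCovIter)
open B8Eq155JBound (Jcur wsup)
open B8ScaledSupNorm (bondNorm msup weight Bdd)
open B7Prop3Flat (c3)
open B7Eq78Linearization (conjR)
open B8Prop3GaugeFixedKLevel (logField_spec mem_unitaryUnits_of_mgauge_eq mulCfg_eq_gaugeAct_of_mgauge_eq inAk_congr_of_sideTouches
  expCfg_iEta_eq_cfgExp cfgExp_congr_at thm4_exists_all_levels_of_b9)

-- `Site` alone could resolve to the torus sites of `Setup.lean`; re-export the `ℤ^d` sites of `B7Prop1Explicit`.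
export B7Prop1Explicit (Site)

variable {d : ℕ}

section Main

variable {𝔸 : Type*} [CStarAlgebra 𝔸] [Nontrivial 𝔸]

/-! ## §1 The masked exponent field of a delivered gauge-fixed field -/

omit [Nontrivial 𝔸] in
/-- **THE EXPONENT FIELD OF THE FINAL GAUGE-FIXED FIELD** (n04-b's §4 construction, as a theorem): if `W` is unitary-valued and on the
bonds `E j = SideTouches (Ω j)`, `j ≤ k`, `W_b = e^{iηA_b}` with `‖A_b‖ ≤ c⋆(Lʲη)⁻¹`, `16c⋆ ≤ 1`, `L ≥ 1`, then there is a field `A′` —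
`(1/iη) log W` on `⋃_{j ≤ k} E j`, `0` elsewhere — which is SELF-ADJOINT EVERYWHERE, equals `A` on the `E j` with `W = e^{iηA′}` there, and
vanishes off them (`logField_spec`: the `log` of a unitary near `1`). [cite: Balaban1985RegularSpaces, (1.36) p.82, p.89 («A₀ = (1/iη) log U′»)] -/
theorem exists_maskedLogField {η : ℝ} (hη : 0 < η) {L : ℕ} (hL : 1 ≤ L) (k : ℕ) (U₀ : Site d → Fin d → 𝔸ˣ)
    {W : Site d → Fin d → 𝔸ˣ} (hWu : ∀ x κ, W x κ ∈ unitaryUnits 𝔸) {A : Site d → Fin d → 𝔸} {cstar : ℝ}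
    (hc0 : 0 ≤ cstar) (hc16 : 16 * cstar ≤ 1) (Ω : ℕ → Set (Site d))
    (hWA : ∀ j, j ≤ k → ∀ y τ, SideTouches (Ω j) y τ → W y τ = cfgExp η A y τ ∧ ‖A y τ‖ ≤ cstar * ((L : ℝ) ^ j * η)⁻¹) :
    ∃ A' : Site d → Fin d → 𝔸, (∀ y τ, IsSelfAdjoint (A' y τ)) ∧
      (∀ j, j ≤ k → ∀ y τ, SideTouches (Ω j) y τ → A' y τ = A y τ ∧ W y τ = cfgExp η A' y τ) ∧
      (∀ y τ, (∀ j, j ≤ k → ¬ SideTouches (Ω j) y τ) → A' y τ = 0) := by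
  classical
  have hLr : (1 : ℝ) ≤ L := by exact_mod_cast hL
  have hc16' : cstar ≤ 1 / 16 := by linarith
  set M : Set (Site d × Fin d) := {b | ∃ j, j ≤ k ∧ SideTouches (Ω j) b.1 b.2} with hM_def
  set A' : Site d → Fin d → 𝔸 :=
    fun y τ => M.indicator (fun b : Site d × Fin d => η⁻¹ • ((I⁻¹ : ℂ) • mlog ((W b.1 b.2 : 𝔸ˣ) : 𝔸))) (y, τ) with hA'_def
  have hsock : ∀ j, j ≤ k → ∀ y τ, SideTouches (Ω j) y τ →
      A' y τ = A y τ ∧ IsSelfAdjoint (A' y τ) ∧ W y τ = cfgExp η A' y τ := by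
    intro j hj y τ hs
    have hmem : (y, τ) ∈ M := ⟨j, hj, hs⟩
    obtain ⟨hWA₁, hA₁⟩ := hWA j hj y τ hs
    have hLj : (1 : ℝ) ≤ (L : ℝ) ^ j := one_le_pow₀ hLr
    have hA₂ : ‖A y τ‖ ≤ cstar * η⁻¹ := by
      calc ‖A y τ‖ ≤ cstar * ((L : ℝ) ^ j * η)⁻¹ := hA₁
        _ = cstar * η⁻¹ * ((L : ℝ) ^ j)⁻¹ := by rw [mul_inv]; ring
        _ ≤ cstar * η⁻¹ * 1 := by
            apply mul_le_mul_of_nonneg_left (inv_le_one_of_one_le₀ hLj) (by positivity)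
        _ = cstar * η⁻¹ := mul_one _
    obtain ⟨hlog, hsa, hexp⟩ := logField_spec hη U₀ hWu hWA₁ hA₂ hc16'
    have hA'y : A' y τ = η⁻¹ • ((I⁻¹ : ℂ) • mlog ((W y τ : 𝔸ˣ) : 𝔸)) := by
      simp only [hA'_def, Set.indicator_of_mem hmem]
    refine ⟨by rw [hA'y, hlog], by rw [hA'y]; exact hsa, ?_⟩
    rw [hexp]
    exact cfgExp_congr_at η hA'y.symm
  refine ⟨A', ?_, fun j hj y τ hs => ⟨(hsock j hj y τ hs).1, (hsock j hj y τ hs).2.2⟩, ?_⟩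
  · intro y τ
    by_cases hmem : (y, τ) ∈ M
    · obtain ⟨j, hj, hs⟩ := hmem
      exact (hsock j hj y τ hs).2.1
    · have : A' y τ = 0 := by simp only [hA'_def, Set.indicator_of_notMem hmem]
      rw [this]; exact IsSelfAdjoint.zero 𝔸
  · intro y τ h
    have hnot : (y, τ) ∉ M := fun ⟨j, hj, hs⟩ => h j hj hs
    simp only [hA'_def, Set.indicator_of_notMem hnot]

/-! ## §2 Proposition 3 for the FINAL level-`k` gauge-fixed field: all members, modulo the (1.59) in-edge and the (1.42) clause -/

/-- **PROPOSITION 3 FOR THE FINAL LEVEL-`k` GAUGE-FIXED FIELD OF THEOREM 4's INDUCTION, ALL MEMBERS** ([Balaban1985RegularSpaces] Prop. 3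
p. 87 with (1.62) «B₁ = 5dLB₀, B₂(β₀) = 5dLB₀(β₀)»; Theorem 2 p. 83; p. 88 «Of course this theorem implies Theorem 2»).  Data: `(u, W, A′)` with
`u` unitary-valued, `W^{u} = U′` (moving frame at `U₀`), (1.29) `Restr129 L k (Λs k) U₀ u`, the Landau predicate `Lan k W` (`Lan` ARBITRARY), and
the exponent field `A′` of §1 at the RESET constant `c⋆ = 5dLB₀(α₀ + α₁)` (self-adjoint everywhere, `W = e^{iηA′}` and `‖A′‖ ≤ c⋆(Lʲη)⁻¹` on
`E j = SideTouches (Ω j)`, `j ≤ k`, `0` off them).  Conclusion: with `a := |A′|₍₋₁₎`, `g := |∇^η_{U₀}A′|₍₋₂₎` (weighted suprema over the `E j`,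
`B8ScaledSupNorm.msup`), `|D^{η*}_{U₀}D^η_{U₀}A′|₍₋₃₎ = bondNorm (−3) (pdiv ∘ plaqCovDeriv A′)` (CONCRETE), and the (1.39)₂ ∕ Hölder functionals `Lp A′`, `Hol A′`
(ABSTRACT, tied to `A′` through their (1.59) lines only — M3's treatment): `a, g, |D*DA′|₍₋₃₎, Lp A′ ≤ 5dLB₀(α₀ + α₁)` and
`Hol A′ ≤ 5dL·B₀β·(α₀ + α₁)`.  PROOF = n05-b's `prop3_norms_kLevel` + `prop3_fifth_kLevel`
at `k` levels, `α₂ := c⋆`: (1.40)₀ = (1.33) `h33`; (1.40)₁ = (1.34) `h34` moved to `WU₀ = (U′U₀)^{u⁻¹}` by gauge invariance of `𝔄_k`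
(`B8Ineq132.inAk_gaugeAct_iff`) and to `e^{iηA′}U₀` by locality (`inAk_congr_of_sideTouches`); (1.41) = the c⋆-socket; (1.59) = `H59full`
(THE IN-EDGE b9 = Thm 3.3 of [Balaban1985BackgroundPropagators] for `G(U₀)`, `H(U₀)`: ONE outer ∀-hypothesis per `(u, W, A′)` under the
guards — where print consumes `Lan k W` and (1.29) through (1.57)–(1.58)); (1.42) = `H42` (n04-b's shape at the c⋆ guard).  HONEST SCOPE:
Proposition 3 is not re-proved (M3 by name); `Lp`, `Hol` are parameters; windows = M3's at `α₂ = c⋆`; count-neutral.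
[cite: Balaban1985RegularSpaces, Prop. 3 (1.62) p.87, Thm 2 (1.36)–(1.39) pp.82–83, Thm 4 p.88] -/
theorem thm2_norms_gaugeFixed_kLevel (hd2 : 2 ≤ d) {η : ℝ} (hη : 0 < η) {L : ℕ} (hL : 2 ≤ L) (k : ℕ)
    {U₀ U' : Site d → Fin d → 𝔸ˣ} (hU₀ : ∀ x κ, U₀ x κ ∈ unitaryUnits 𝔸)
    {α₀ α₁ B₀ B₀β cstar : ℝ} (hα₀ : 0 < α₀) (hα₁ : 0 ≤ α₁) (hB₀ : 0 ≤ B₀) (hB₀β : 0 ≤ B₀β)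
    (hc : cstar = 5 * d * L * B₀ * (α₀ + α₁))
    (hα3 : C0 d * α₀ ≤ 1 / 3) (hα4 : 4 * α₀ ≤ c2' d L)
    (h16 : 16 * cstar ≤ 1) (hd5 : 5 * cstar * ((d : ℝ) - 1) ≤ 4)
    (hsmall : Real.exp (4 * (800 * ((d : ℝ) + 1) ^ 2 * ((d : ℝ) + 4)) * α₀)
      * (1 + 8 * (131072 * ((d : ℝ) + 1) ^ 2) * cstar) ≤ 2)
    (hc₃ : 2 * cstar ≤ c3 d L) (hside : 36 * d * B₀ * cstar ≤ 1 / 2) (h50 : 50 * d * cstar ≤ 1)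
    {C₂ : ℝ} (hC₂ : 8 * (131072 * ((d : ℝ) + 1) ^ 2) * Real.exp (4 * (800 * ((d : ℝ) + 1) ^ 2 * ((d : ℝ) + 4)) * α₀) ≤ C₂)
    (h61 : 2 * cstar ^ 2 + 20 * d * α₀ * cstar + 2 * C₂ * cstar ^ 2 ≤ α₀ + α₁)
    (Ω : ℕ → Set (Site d)) (Λs : ℕ → ℕ → Set (Site d)) (Λb : ℕ → ℕ → Set (Site d × Fin d))
    (hbox : ∀ j, j ≤ k → ∀ c ∈ Λb k j, ∀ x, InBox (loK L j c.1) (bondHiK L j c.1 c.2) x → x ∈ Ω j)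
    (h33 : InAk L k η α₀ Ω U₀) (h34 : InAk L k η α₀ Ω (mulCfg U' U₀))
    (Lan : ℕ → (Site d → Fin d → 𝔸ˣ) → Prop) (Lp Hol : (Site d → Fin d → 𝔸) → ℝ)
    (H42 : ∀ (u : Site d → 𝔸ˣ) (W : Site d → Fin d → 𝔸ˣ) (A' : Site d → Fin d → 𝔸),
      (∀ x, u x ∈ unitaryUnits 𝔸) → mgauge U₀ u W = U' → Restr129 L k (Λs k) U₀ u → Lan k W →
      (∀ y τ, IsSelfAdjoint (A' y τ)) →
      (∀ j, j ≤ k → ∀ y τ, SideTouches (Ω j) y τ →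
        W y τ = cfgExp η A' y τ ∧ ‖A' y τ‖ ≤ cstar * ((L : ℝ) ^ j * η)⁻¹) →
      (∀ y τ, (∀ j, j ≤ k → ¬ SideTouches (Ω j) y τ) → A' y τ = 0) →
      ∀ j, j ≤ k → ∀ c ∈ Λb k j, ‖logCovIter L U₀ (iEta η A') j c.1 c.2‖ < 2 * d * L * α₁)
    (H59full : ∀ (u : Site d → 𝔸ˣ) (W : Site d → Fin d → 𝔸ˣ) (A' : Site d → Fin d → 𝔸),
      (∀ x, u x ∈ unitaryUnits 𝔸) → mgauge U₀ u W = U' → Restr129 L k (Λs k) U₀ u → Lan k W →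
      (∀ y τ, IsSelfAdjoint (A' y τ)) →
      (∀ j, j ≤ k → ∀ y τ, SideTouches (Ω j) y τ →
        W y τ = cfgExp η A' y τ ∧ ‖A' y τ‖ ≤ cstar * ((L : ℝ) ^ j * η)⁻¹) →
      (∀ y τ, (∀ j, j ≤ k → ¬ SideTouches (Ω j) y τ) → A' y τ = 0) →
      msup L k η (-(1 : ℝ)) (fun j (b : Site d × Fin d) => SideTouches (Ω j) b.1 b.2) (fun b => A' b.1 b.2)
          ≤ B₀ * (bondNorm L k η (-(3 : ℝ)) Ω (fun x μ => Jcur η U₀ A' μ x)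
            + wsup 1 (fun p : {p : ℕ × (Site d × Fin d) // p.1 ≤ k ∧ p.2 ∈ Λb k p.1} =>
                linCovIter L U₀ (iEta η A') p.1.1 p.1.2.1 p.1.2.2)) ∧
        msup L k η (-(2 : ℝ)) (fun j (t : Fin d × Fin d × Site d) => SideTouches (Ω j) t.2.2 t.2.1)
            (fun t => covDerivFwd η U₀ t.1 (fun z => A' z t.2.1) t.2.2)
          ≤ B₀ * (bondNorm L k η (-(3 : ℝ)) Ω (fun x μ => Jcur η U₀ A' μ x)
            + wsup 1 (fun p : {p : ℕ × (Site d × Fin d) // p.1 ≤ k ∧ p.2 ∈ Λb k p.1} =>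
                linCovIter L U₀ (iEta η A') p.1.1 p.1.2.1 p.1.2.2)) ∧
        bondNorm L k η (-(3 : ℝ)) Ω (fun x μ => pdiv η U₀ (plaqCovDeriv η U₀ A') μ x)
          ≤ B₀ * (bondNorm L k η (-(3 : ℝ)) Ω (fun x μ => Jcur η U₀ A' μ x)
            + wsup 1 (fun p : {p : ℕ × (Site d × Fin d) // p.1 ≤ k ∧ p.2 ∈ Λb k p.1} =>
                linCovIter L U₀ (iEta η A') p.1.1 p.1.2.1 p.1.2.2)) ∧
        Lp A' ≤ B₀ * (bondNorm L k η (-(3 : ℝ)) Ω (fun x μ => Jcur η U₀ A' μ x)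
            + wsup 1 (fun p : {p : ℕ × (Site d × Fin d) // p.1 ≤ k ∧ p.2 ∈ Λb k p.1} =>
                linCovIter L U₀ (iEta η A') p.1.1 p.1.2.1 p.1.2.2)) ∧
        Hol A' ≤ B₀β * (bondNorm L k η (-(3 : ℝ)) Ω (fun x μ => Jcur η U₀ A' μ x)
            + wsup 1 (fun p : {p : ℕ × (Site d × Fin d) // p.1 ≤ k ∧ p.2 ∈ Λb k p.1} =>
                linCovIter L U₀ (iEta η A') p.1.1 p.1.2.1 p.1.2.2)))
    {u : Site d → 𝔸ˣ} {W : Site d → Fin d → 𝔸ˣ} {A' : Site d → Fin d → 𝔸}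
    (hu : ∀ x, u x ∈ unitaryUnits 𝔸) (hW : mgauge U₀ u W = U') (h129 : Restr129 L k (Λs k) U₀ u) (hLan : Lan k W)
    (hA'sa : ∀ y τ, IsSelfAdjoint (A' y τ))
    (hA'41 : ∀ j, j ≤ k → ∀ y τ, SideTouches (Ω j) y τ →
      W y τ = cfgExp η A' y τ ∧ ‖A' y τ‖ ≤ cstar * ((L : ℝ) ^ j * η)⁻¹)
    (hA'0 : ∀ y τ, (∀ j, j ≤ k → ¬ SideTouches (Ω j) y τ) → A' y τ = 0) :
    msup L k η (-(1 : ℝ)) (fun j (b : Site d × Fin d) => SideTouches (Ω j) b.1 b.2) (fun b => A' b.1 b.2)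
        ≤ 5 * d * L * B₀ * (α₀ + α₁) ∧
      msup L k η (-(2 : ℝ)) (fun j (t : Fin d × Fin d × Site d) => SideTouches (Ω j) t.2.2 t.2.1)
          (fun t => covDerivFwd η U₀ t.1 (fun z => A' z t.2.1) t.2.2) ≤ 5 * d * L * B₀ * (α₀ + α₁) ∧
      bondNorm L k η (-(3 : ℝ)) Ω (fun x μ => pdiv η U₀ (plaqCovDeriv η U₀ A') μ x) ≤ 5 * d * L * B₀ * (α₀ + α₁) ∧
      Lp A' ≤ 5 * d * L * B₀ * (α₀ + α₁) ∧
      Hol A' ≤ 5 * d * L * B₀β * (α₀ + α₁) := by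
  have hL1 : 1 ≤ L := le_trans (by norm_num) hL
  have hLr : (1 : ℝ) ≤ L := by exact_mod_cast hL1
  have hcstar : 0 ≤ cstar := by rw [hc]; positivity
  -- global bound `‖A′‖ ≤ c⋆η⁻¹`
  have hA'glob : ∀ y τ, ‖A' y τ‖ ≤ cstar * η⁻¹ := by
    intro y τ
    by_cases hmem : ∃ j, j ≤ k ∧ SideTouches (Ω j) y τ
    · obtain ⟨j, hj, hs⟩ := hmem
      have hLj : (1 : ℝ) ≤ (L : ℝ) ^ j := one_le_pow₀ hLr
      calc ‖A' y τ‖ ≤ cstar * ((L : ℝ) ^ j * η)⁻¹ := (hA'41 j hj y τ hs).2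
        _ = cstar * η⁻¹ * ((L : ℝ) ^ j)⁻¹ := by rw [mul_inv]; ring
        _ ≤ cstar * η⁻¹ * 1 := by
            apply mul_le_mul_of_nonneg_left (inv_le_one_of_one_le₀ hLj) (by positivity)
        _ = cstar * η⁻¹ := mul_one _
    · have h0 : A' y τ = 0 := hA'0 y τ fun j hj hs => hmem ⟨j, hj, hs⟩
      rw [h0, norm_zero]; positivity
  -- the in-edge (1.59) (all five lines) and the (1.42) clause for `A′`
  obtain ⟨h59a, h59g, h59j, h59l, h59h⟩ := H59full u W A' hu hW h129 hLan hA'sa hA'41 hA'0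
  have h42 := H42 u W A' hu hW h129 hLan hA'sa hA'41 hA'0
  -- (1.40) for `U₀` and for `e^{iηA′}U₀`
  have h40W : InAk L k η α₀ Ω (mulCfg W U₀) := by
    have hui : ∀ x, u⁻¹ x ∈ U1 𝔸 := fun x => unitaryUnits_le_U1 ((unitaryUnits 𝔸).inv_mem (hu x))
    rw [mulCfg_eq_gaugeAct_of_mgauge_eq hW]
    exact (B8Ineq132.inAk_gaugeAct_iff L k η α₀ Ω hui _).2 h34
  have h40₁ : InAk L k η α₀ Ω (mulCfg (expCfg (iEta η A')) U₀) := by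
    refine (inAk_congr_of_sideTouches L k η α₀ (V := mulCfg W U₀) fun j hj y τ hs => ?_).1 h40W
    show W y τ * U₀ y τ = expCfg (iEta η A') y τ * U₀ y τ
    rw [(hA'41 j hj y τ hs).1, expCfg_iEta_eq_cfgExp]
  -- boundedness of the gradient family and the gradient datum
  have hU₀1 : ∀ x κ, U₀ x κ ∈ U1 𝔸 := fun x κ => unitaryUnits_le_U1 (hU₀ x κ)
  have hgrad : ∀ (y : Site d) (κ τ : Fin d), ‖covDerivFwd η U₀ κ (fun z => A' z τ) y‖ ≤ 2 * cstar * η⁻¹ * η⁻¹ := by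
    intro y κ τ
    unfold covDerivFwd
    rw [norm_smul, norm_inv, Real.norm_eq_abs, abs_of_pos hη]
    have h1 : ‖conjR (U₀ y κ) (A' (y + e κ) τ) - A' y τ‖ ≤ cstar * η⁻¹ + cstar * η⁻¹ := by
      calc ‖conjR (U₀ y κ) (A' (y + e κ) τ) - A' y τ‖
          ≤ ‖conjR (U₀ y κ) (A' (y + e κ) τ)‖ + ‖A' y τ‖ := norm_sub_le _ _
        _ ≤ cstar * η⁻¹ + cstar * η⁻¹ := by
            rw [B8Ineq132.norm_conjR (hU₀1 y κ)]
            exact add_le_add (hA'glob _ _) (hA'glob _ _)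
    calc η⁻¹ * ‖conjR (U₀ y κ) (A' (y + e κ) τ) - A' y τ‖ ≤ η⁻¹ * (cstar * η⁻¹ + cstar * η⁻¹) :=
        mul_le_mul_of_nonneg_left h1 (by positivity)
      _ = 2 * cstar * η⁻¹ * η⁻¹ := by ring
  have hBg : Bdd L k η (-(2 : ℝ)) (fun j (t : Fin d × Fin d × Site d) => SideTouches (Ω j) t.2.2 t.2.1)
      (fun t => covDerivFwd η U₀ t.1 (fun z => A' z t.2.1) t.2.2) := by
    have e2 : (-(2 : ℝ)) = -((2 : ℕ) : ℝ) := by norm_num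
    rw [e2]
    refine B8ScaledSupNorm.bdd_of_forall (c := 2 * cstar * ((L : ℝ) ^ k) ^ 2) fun j hj t _ => ?_
    rw [B8ScaledSupNorm.weight_neg_natCast L η 2 j]
    have hLjk : (L : ℝ) ^ j ≤ (L : ℝ) ^ k := pow_le_pow_right₀ hLr hj
    have hLj0 : (0 : ℝ) ≤ (L : ℝ) ^ j := by positivity
    calc ((L : ℝ) ^ j * η) ^ 2 * ‖covDerivFwd η U₀ t.1 (fun z => A' z t.2.1) t.2.2‖
        ≤ ((L : ℝ) ^ j * η) ^ 2 * (2 * cstar * η⁻¹ * η⁻¹) := mul_le_mul_of_nonneg_left (hgrad _ _ _) (by positivity)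
      _ = 2 * cstar * ((L : ℝ) ^ j) ^ 2 := by field_simp
      _ ≤ 2 * cstar * ((L : ℝ) ^ k) ^ 2 := by gcongr
  set g : ℝ := msup L k η (-(2 : ℝ)) (fun j (t : Fin d × Fin d × Site d) => SideTouches (Ω j) t.2.2 t.2.1)
      (fun t => covDerivFwd η U₀ t.1 (fun z => A' z t.2.1) t.2.2) with hg_def
  have hg0 : 0 ≤ g := B8ScaledSupNorm.msup_nonneg L k hη.le _ _ _
  have hg : ∀ j, j ≤ k → ∀ (y : Site d) (κ τ : Fin d), SideTouches (Ω j) y τ →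
      ((L : ℝ) ^ j * η) ^ 2 * ‖covDerivFwd η U₀ κ (fun z => A' z τ) y‖ ≤ g := by
    intro j hj y κ τ hs
    have h := B8ScaledSupNorm.weight_mul_norm_le_msup hBg hj (i := (κ, τ, y)) hs
    have hw : weight L η (-(2 : ℝ)) j = ((L : ℝ) ^ j * η) ^ 2 := by
      have e2 : (-(2 : ℝ)) = -((2 : ℕ) : ℝ) := by norm_num
      rw [e2, B8ScaledSupNorm.weight_neg_natCast L η 2 j]
    rw [hw] at h
    exact h
  have h41 : ∀ j, j ≤ k → ∀ y τ, SideTouches (Ω j) y τ → ‖A' y τ‖ ≤ cstar * ((L : ℝ) ^ j * η)⁻¹ :=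
    fun j hj y τ hs => (hA'41 j hj y τ hs).2
  -- PROPOSITION 3 at `k` levels for `A′` (n05-b's `prop3_norms_kLevel`, all four members) …
  obtain ⟨ha, hg', hj, hl⟩ := B8Prop3KLevel.prop3_norms_kLevel hd2 hη hL hU₀ hA'sa hα₀ hα₁ hcstar hg0 hα3 hα4 h16 hd5
    hsmall hc₃ hB₀ hside h50 hC₂ h61 hbox h33 h40₁ h41 hg h42 h59a h59g h59j h59l
  -- … and the Hölder member (`prop3_fifth_kLevel`)
  have hh := B8Prop3KLevel.prop3_fifth_kLevel hd2 hη hL hU₀ hA'sa hα₀ hα₁ hcstar hg0 hα3 hα4 h16 hd5 hsmall hc₃ hB₀ hB₀β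
    hside h50 hC₂ h61 hbox h33 h40₁ h41 hg h42 h59g h59h
  exact ⟨ha, hg', hj, hl, hh⟩

omit [Nontrivial 𝔸] in
/-- **(1.36)₁ AS PRINTED, pointwise** «|A| < B₁(α₀ + α₁)(Lʲη)⁻¹ on Ω_j», `B₁ = 5dLB₀`: from the norm bound `|A′|₍₋₁₎ ≤ R` of
`thm2_norms_gaugeFixed_kLevel` (weighted supremum over the `E j`) and the c⋆-socket (boundedness of the family), `‖A′_b‖ ≤ R·(Lʲη)⁻¹` at every
`b ∈ E j`, `j ≤ k`. [cite: Balaban1985RegularSpaces, (1.36) p.82, Prop. 3 (1.62) p.87] -/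
theorem thm2_pointwise_A {η : ℝ} (hη : 0 < η) {L : ℕ} (hL : 1 ≤ L) {k : ℕ} {A' : Site d → Fin d → 𝔸} {cstar R : ℝ}
    {Ω : ℕ → Set (Site d)} (h41 : ∀ j, j ≤ k → ∀ y τ, SideTouches (Ω j) y τ → ‖A' y τ‖ ≤ cstar * ((L : ℝ) ^ j * η)⁻¹)
    (ha : msup L k η (-(1 : ℝ)) (fun j (b : Site d × Fin d) => SideTouches (Ω j) b.1 b.2) (fun b => A' b.1 b.2) ≤ R)
    {j : ℕ} (hj : j ≤ k) {y : Site d} {τ : Fin d} (hs : SideTouches (Ω j) y τ) :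
    ‖A' y τ‖ ≤ R * ((L : ℝ) ^ j * η)⁻¹ := by
  have hBa : Bdd L k η (-(1 : ℝ)) (fun j (b : Site d × Fin d) => SideTouches (Ω j) b.1 b.2) fun b => A' b.1 b.2 := by
    have e1 : (-(1 : ℝ)) = -((1 : ℕ) : ℝ) := by norm_num
    rw [e1]
    refine B8ScaledSupNorm.bdd_of_forall (c := cstar) fun j hj b hb => ?_
    have hsc : 0 < (L : ℝ) ^ j * η := B8ScaledSupNorm.scale_pos hL hη j
    rw [B8ScaledSupNorm.weight_neg_natCast L η 1 j, pow_one]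
    calc (L : ℝ) ^ j * η * ‖A' b.1 b.2‖ ≤ (L : ℝ) ^ j * η * (cstar * ((L : ℝ) ^ j * η)⁻¹) :=
        mul_le_mul_of_nonneg_left (h41 j hj b.1 b.2 hb) hsc.le
      _ = cstar := by field_simp
  have hpt := B8ScaledSupNorm.norm_le_of_msup_le hL hη hBa ha hj (i := (y, τ)) hs
  rw [Real.rpow_neg_one] at hpt
  exact hpt

/-! (1.36)₂ pointwise «|∇^η_{U₀}A| < B₁(α₀ + α₁)(Lʲη)⁻²» from the `g`-bound is `B8Prop3KLevel.prop3_pointwise_grad_kLevel` BY NAME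
(boundedness of the gradient family: the `hBg` step inside `thm2_norms_gaugeFixed_kLevel`). -/

/-! ## §3 The corollary: Theorem 2's existence half AT OBJECTS, modulo sockets (p. 88 «Of course this theorem implies Theorem 2») -/

/-- **THEOREM 2 ([Balaban1985RegularSpaces] p. 83), EXISTENCE HALF, AT OBJECTS ON THE CONCRETE `ℤᵈ` CARRIERS, MODULO SOCKETS** — p. 88:
«Theorem 4. … Of course this theorem implies Theorem 2»: for `k ≥ 1`, THERE IS a unitary-valued gauge transformation `u` with (1.29)
`Restr129 L k (Λs k) U₀ u`, whose gauge-fixed field `W` (`W^{u} = U′`) satisfies `Lan k W`, together with a self-adjoint exponent field `A′`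
with `W = e^{iηA′}` and (1.36)₁ `‖A′‖ ≤ c⋆(Lʲη)⁻¹` on the `E j = SideTouches (Ω j)`, `j ≤ k` (`c⋆ = 5dLB₀(α₀ + α₁) = B₁(α₀ + α₁)`), `A′ = 0`
off them, AND the remaining members of (1.36)∕(1.39) as norm bounds: `|A′|₍₋₁₎, |∇^η_{U₀}A′|₍₋₂₎, |D^{η*}D^ηA′|₍₋₃₎ (concrete), Lp A′ ≤ 5dLB₀(α₀ + α₁)`,
`Hol A′ ≤ 5dL·B₀β·(α₀ + α₁)` (`B₂(β₀) = 5dLB₀(β₀)`).  = `B8Prop3GaugeFixedKLevel.thm4_exists_all_levels_of_b9` at `m = k` (Theorem 4's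
existence clause, modulo Proposition 5's sockets `hP5base`∕`hP5`, the (1.59) in-edge `H59` and the (1.42) clause `H42` at the induction's
guard `2Lc⋆ + 8α₄`, (1.33)∕(1.34)∕(1.66)₀) ∘ `exists_maskedLogField` ∘ `thm2_norms_gaugeFixed_kLevel` (modulo `H59full`∕`H42⋆` at the c⋆
guard and M3's windows at `α₂ = c⋆`).  The abstract-leaf twin is `B8Thm2AtConstants.thm2ExistsAt_of_bodies`.  HONEST SCOPE: Props 3∕5,
Thm 4's induction, (1.59), (1.42) are hypotheses∕by name; uniqueness not touched; `Lp`, `Hol` abstract functionals; count-neutral.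
[cite: Balaban1985RegularSpaces, Thm 2 p.83, Thm 4 p.88, Prop. 3 (1.62) p.87, (1.36)–(1.39) pp.82–83] -/
theorem thm2_exists_gaugeFixed_kLevel (hd2 : 2 ≤ d) {η : ℝ} (hη : 0 < η) {L : ℕ} (hL : 2 ≤ L) {k : ℕ} (hk : 1 ≤ k)
    {U₀ U' : Site d → Fin d → 𝔸ˣ} (hU₀ : ∀ x κ, U₀ x κ ∈ unitaryUnits 𝔸) (hU' : ∀ x κ, U' x κ ∈ unitaryUnits 𝔸)
    {α₀ α₁ α₄ B₀ B₀β cstar a : ℝ} (hα₀ : 0 < α₀) (hα₁ : 0 ≤ α₁) (hα₄ : 0 ≤ α₄) (hB₀ : 0 ≤ B₀) (hB₀β : 0 ≤ B₀β)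
    (hc : cstar = 5 * d * L * B₀ * (α₀ + α₁))
    (hs₁ : α₄ ≤ 1 / 84) (hs₂ : L * cstar ≤ 1 / 12) (ha : a ≤ 1 / 4) (ha2 : 2 * a ≤ cstar)
    (hα3 : C0 d * α₀ ≤ 1 / 3) (hα4 : 4 * α₀ ≤ c2' d L)
    -- Theorem 4's windows (at `α₂ = 2Lc⋆ + 8α₄`)
    (h16 : 16 * (2 * (L * cstar) + 8 * α₄) ≤ 1) (hd5 : 5 * (2 * (L * cstar) + 8 * α₄) * ((d : ℝ) - 1) ≤ 4)
    (hsmall : Real.exp (4 * (800 * ((d : ℝ) + 1) ^ 2 * ((d : ℝ) + 4)) * α₀)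
      * (1 + 8 * (131072 * ((d : ℝ) + 1) ^ 2) * (2 * (L * cstar) + 8 * α₄)) ≤ 2)
    (hc₃ : 2 * (2 * (L * cstar) + 8 * α₄) ≤ c3 d L) (hside : 36 * d * B₀ * (2 * (L * cstar) + 8 * α₄) ≤ 1 / 2)
    (h50 : 50 * d * (2 * (L * cstar) + 8 * α₄) ≤ 1)
    {C₂ : ℝ} (hC₂ : 8 * (131072 * ((d : ℝ) + 1) ^ 2) * Real.exp (4 * (800 * ((d : ℝ) + 1) ^ 2 * ((d : ℝ) + 4)) * α₀) ≤ C₂)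
    (h61 : 2 * (2 * (L * cstar) + 8 * α₄) ^ 2 + 20 * d * α₀ * (2 * (L * cstar) + 8 * α₄)
      + 2 * C₂ * (2 * (L * cstar) + 8 * α₄) ^ 2 ≤ α₀ + α₁)
    -- this file's windows (at `α₂ = c⋆`, the reset constant of the final field)
    (h16' : 16 * cstar ≤ 1) (hd5' : 5 * cstar * ((d : ℝ) - 1) ≤ 4)
    (hsmall' : Real.exp (4 * (800 * ((d : ℝ) + 1) ^ 2 * ((d : ℝ) + 4)) * α₀)
      * (1 + 8 * (131072 * ((d : ℝ) + 1) ^ 2) * cstar) ≤ 2)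
    (hc₃' : 2 * cstar ≤ c3 d L) (hside' : 36 * d * B₀ * cstar ≤ 1 / 2) (h50' : 50 * d * cstar ≤ 1)
    (h61' : 2 * cstar ^ 2 + 20 * d * α₀ * cstar + 2 * C₂ * cstar ^ 2 ≤ α₀ + α₁)
    (Ω : ℕ → Set (Site d)) (hΩ : ∀ j, Ω (j + 1) ⊆ Ω j) (Λs : ℕ → ℕ → Set (Site d)) (Λb : ℕ → ℕ → Set (Site d × Fin d))
    (hbox : ∀ m, m ≤ k → ∀ j, j ≤ m → ∀ c ∈ Λb m j, ∀ x, InBox (loK L j c.1) (bondHiK L j c.1 c.2) x → x ∈ Ω j)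
    (h33 : InAk L k η α₀ Ω U₀) (h34 : InAk L k η α₀ Ω (mulCfg U' U₀))
    (h66 : ∀ b ∈ {b : Site d × Fin d | SideTouches (Ω 0) b.1 b.2}, ‖((U' b.1 b.2 : 𝔸ˣ) : 𝔸) - 1‖ ≤ a)
    (Lan : ℕ → (Site d → Fin d → 𝔸ˣ) → Prop) (Lp Hol : (Site d → Fin d → 𝔸) → ℝ)
    -- Proposition 5's sockets (Theorem 4's induction), verbatim from `thm4_exists_all_levels_of_b9`
    (hP5base : ∃ (v : Site d → 𝔸ˣ) (lam : Site d → 𝔸), (∀ x, v x ∈ unitaryUnits 𝔸) ∧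
        (∀ j, j ≤ 1 → ∀ b ∈ {b : Site d × Fin d | SideTouches (Ω j) b.1 b.2}, (v b.1 : 𝔸) = ((gaugeExp lam b.1 : 𝔸ˣ) : 𝔸) ∧
          (v (b.1 + e b.2) : 𝔸) = ((gaugeExp lam (b.1 + e b.2) : 𝔸ˣ) : 𝔸)) ∧
        (∀ j, j ≤ 1 → ∀ b ∈ {b : Site d × Fin d | SideTouches (Ω j) b.1 b.2},
          ‖lam b.1‖ ≤ α₄ ∧ ((L : ℝ) ^ j * η) * ‖covDerivFwd η U₀ b.2 lam b.1‖ ≤ α₄) ∧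
        Lan 1 (mgauge U₀ v⁻¹ U') ∧ Restr129 L 1 (Λs 1) U₀ ((1 : Site d → 𝔸ˣ) * v))
    (hP5 : ∀ m, 1 ≤ m → m < k → ∀ (u₁ : Site d → 𝔸ˣ) (U₁ : Site d → Fin d → 𝔸ˣ) (A : Site d → Fin d → 𝔸),
      (∀ x, u₁ x ∈ unitaryUnits 𝔸) → mgauge U₀ u₁ U₁ = U' → Restr129 L m (Λs m) U₀ u₁ → Lan m U₁ →
      (∀ j, j ≤ m → ∀ b ∈ {b : Site d × Fin d | SideTouches (Ω j) b.1 b.2},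
        U₁ b.1 b.2 = cfgExp η A b.1 b.2 ∧ IsSelfAdjoint (A b.1 b.2) ∧ ‖A b.1 b.2‖ ≤ cstar * ((L : ℝ) ^ j * η)⁻¹) →
      ∃ (v : Site d → 𝔸ˣ) (lam : Site d → 𝔸), (∀ x, v x ∈ unitaryUnits 𝔸) ∧
        (∀ j, j ≤ m + 1 → ∀ b ∈ {b : Site d × Fin d | SideTouches (Ω j) b.1 b.2}, (v b.1 : 𝔸) = ((gaugeExp lam b.1 : 𝔸ˣ) : 𝔸) ∧
          (v (b.1 + e b.2) : 𝔸) = ((gaugeExp lam (b.1 + e b.2) : 𝔸ˣ) : 𝔸)) ∧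
        (∀ j, j ≤ m + 1 → ∀ b ∈ {b : Site d × Fin d | SideTouches (Ω j) b.1 b.2},
          ‖lam b.1‖ ≤ α₄ ∧ ((L : ℝ) ^ j * η) * ‖covDerivFwd η U₀ b.2 lam b.1‖ ≤ α₄) ∧
        Lan (m + 1) (mgauge U₀ v⁻¹ U₁) ∧ Restr129 L (m + 1) (Λs (m + 1)) U₀ (u₁ * v))
    -- the (1.42) clause and the (1.59) in-edge for the INDUCTION (guard `2Lc⋆ + 8α₄`), verbatim
    (H42 : ∀ m, 1 ≤ m → m ≤ k → ∀ (u : Site d → 𝔸ˣ) (W : Site d → Fin d → 𝔸ˣ) (A' : Site d → Fin d → 𝔸),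
      (∀ x, u x ∈ unitaryUnits 𝔸) → mgauge U₀ u W = U' → Restr129 L m (Λs m) U₀ u → Lan m W →
      (∀ y τ, IsSelfAdjoint (A' y τ)) →
      (∀ j, j ≤ m → ∀ y τ, SideTouches (Ω j) y τ →
        W y τ = cfgExp η A' y τ ∧ ‖A' y τ‖ ≤ (2 * (L * cstar) + 8 * α₄) * ((L : ℝ) ^ j * η)⁻¹) →
      (∀ y τ, (∀ j, j ≤ m → ¬ SideTouches (Ω j) y τ) → A' y τ = 0) →
      ∀ j, j ≤ m → ∀ c ∈ Λb m j, ‖logCovIter L U₀ (iEta η A') j c.1 c.2‖ < 2 * d * L * α₁)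
    (H59 : ∀ m, 1 ≤ m → m ≤ k → ∀ (u : Site d → 𝔸ˣ) (W : Site d → Fin d → 𝔸ˣ) (A' : Site d → Fin d → 𝔸),
      (∀ x, u x ∈ unitaryUnits 𝔸) → mgauge U₀ u W = U' → Restr129 L m (Λs m) U₀ u → Lan m W →
      (∀ y τ, IsSelfAdjoint (A' y τ)) →
      (∀ j, j ≤ m → ∀ y τ, SideTouches (Ω j) y τ →
        W y τ = cfgExp η A' y τ ∧ ‖A' y τ‖ ≤ (2 * (L * cstar) + 8 * α₄) * ((L : ℝ) ^ j * η)⁻¹) →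
      (∀ y τ, (∀ j, j ≤ m → ¬ SideTouches (Ω j) y τ) → A' y τ = 0) →
      msup L m η (-(1 : ℝ)) (fun j (b : Site d × Fin d) => SideTouches (Ω j) b.1 b.2) (fun b => A' b.1 b.2)
          ≤ B₀ * (bondNorm L m η (-(3 : ℝ)) Ω (fun x μ => Jcur η U₀ A' μ x)
            + wsup 1 (fun p : {p : ℕ × (Site d × Fin d) // p.1 ≤ m ∧ p.2 ∈ Λb m p.1} =>
                linCovIter L U₀ (iEta η A') p.1.1 p.1.2.1 p.1.2.2)) ∧
        msup L m η (-(2 : ℝ)) (fun j (t : Fin d × Fin d × Site d) => SideTouches (Ω j) t.2.2 t.2.1)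
            (fun t => covDerivFwd η U₀ t.1 (fun z => A' z t.2.1) t.2.2)
          ≤ B₀ * (bondNorm L m η (-(3 : ℝ)) Ω (fun x μ => Jcur η U₀ A' μ x)
            + wsup 1 (fun p : {p : ℕ × (Site d × Fin d) // p.1 ≤ m ∧ p.2 ∈ Λb m p.1} =>
                linCovIter L U₀ (iEta η A') p.1.1 p.1.2.1 p.1.2.2)))
    -- the (1.42) clause and the FULL (1.59) in-edge for the FINAL field (guard `c⋆`)
    (H42' : ∀ (u : Site d → 𝔸ˣ) (W : Site d → Fin d → 𝔸ˣ) (A' : Site d → Fin d → 𝔸),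
      (∀ x, u x ∈ unitaryUnits 𝔸) → mgauge U₀ u W = U' → Restr129 L k (Λs k) U₀ u → Lan k W →
      (∀ y τ, IsSelfAdjoint (A' y τ)) →
      (∀ j, j ≤ k → ∀ y τ, SideTouches (Ω j) y τ →
        W y τ = cfgExp η A' y τ ∧ ‖A' y τ‖ ≤ cstar * ((L : ℝ) ^ j * η)⁻¹) →
      (∀ y τ, (∀ j, j ≤ k → ¬ SideTouches (Ω j) y τ) → A' y τ = 0) →
      ∀ j, j ≤ k → ∀ c ∈ Λb k j, ‖logCovIter L U₀ (iEta η A') j c.1 c.2‖ < 2 * d * L * α₁)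
    (H59full : ∀ (u : Site d → 𝔸ˣ) (W : Site d → Fin d → 𝔸ˣ) (A' : Site d → Fin d → 𝔸),
      (∀ x, u x ∈ unitaryUnits 𝔸) → mgauge U₀ u W = U' → Restr129 L k (Λs k) U₀ u → Lan k W →
      (∀ y τ, IsSelfAdjoint (A' y τ)) →
      (∀ j, j ≤ k → ∀ y τ, SideTouches (Ω j) y τ →
        W y τ = cfgExp η A' y τ ∧ ‖A' y τ‖ ≤ cstar * ((L : ℝ) ^ j * η)⁻¹) →
      (∀ y τ, (∀ j, j ≤ k → ¬ SideTouches (Ω j) y τ) → A' y τ = 0) →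
      msup L k η (-(1 : ℝ)) (fun j (b : Site d × Fin d) => SideTouches (Ω j) b.1 b.2) (fun b => A' b.1 b.2)
          ≤ B₀ * (bondNorm L k η (-(3 : ℝ)) Ω (fun x μ => Jcur η U₀ A' μ x)
            + wsup 1 (fun p : {p : ℕ × (Site d × Fin d) // p.1 ≤ k ∧ p.2 ∈ Λb k p.1} =>
                linCovIter L U₀ (iEta η A') p.1.1 p.1.2.1 p.1.2.2)) ∧
        msup L k η (-(2 : ℝ)) (fun j (t : Fin d × Fin d × Site d) => SideTouches (Ω j) t.2.2 t.2.1)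
            (fun t => covDerivFwd η U₀ t.1 (fun z => A' z t.2.1) t.2.2)
          ≤ B₀ * (bondNorm L k η (-(3 : ℝ)) Ω (fun x μ => Jcur η U₀ A' μ x)
            + wsup 1 (fun p : {p : ℕ × (Site d × Fin d) // p.1 ≤ k ∧ p.2 ∈ Λb k p.1} =>
                linCovIter L U₀ (iEta η A') p.1.1 p.1.2.1 p.1.2.2)) ∧
        bondNorm L k η (-(3 : ℝ)) Ω (fun x μ => pdiv η U₀ (plaqCovDeriv η U₀ A') μ x)
          ≤ B₀ * (bondNorm L k η (-(3 : ℝ)) Ω (fun x μ => Jcur η U₀ A' μ x)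
            + wsup 1 (fun p : {p : ℕ × (Site d × Fin d) // p.1 ≤ k ∧ p.2 ∈ Λb k p.1} =>
                linCovIter L U₀ (iEta η A') p.1.1 p.1.2.1 p.1.2.2)) ∧
        Lp A' ≤ B₀ * (bondNorm L k η (-(3 : ℝ)) Ω (fun x μ => Jcur η U₀ A' μ x)
            + wsup 1 (fun p : {p : ℕ × (Site d × Fin d) // p.1 ≤ k ∧ p.2 ∈ Λb k p.1} =>
                linCovIter L U₀ (iEta η A') p.1.1 p.1.2.1 p.1.2.2)) ∧
        Hol A' ≤ B₀β * (bondNorm L k η (-(3 : ℝ)) Ω (fun x μ => Jcur η U₀ A' μ x)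
            + wsup 1 (fun p : {p : ℕ × (Site d × Fin d) // p.1 ≤ k ∧ p.2 ∈ Λb k p.1} =>
                linCovIter L U₀ (iEta η A') p.1.1 p.1.2.1 p.1.2.2))) :
    ∃ u : Site d → 𝔸ˣ, (∀ x, u x ∈ unitaryUnits 𝔸) ∧ Restr129 L k (Λs k) U₀ u ∧
      ∃ W : Site d → Fin d → 𝔸ˣ, mgauge U₀ u W = U' ∧ Lan k W ∧
        ∃ A' : Site d → Fin d → 𝔸, (∀ y τ, IsSelfAdjoint (A' y τ)) ∧
          (∀ j, j ≤ k → ∀ y τ, SideTouches (Ω j) y τ →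
            W y τ = cfgExp η A' y τ ∧ ‖A' y τ‖ ≤ cstar * ((L : ℝ) ^ j * η)⁻¹) ∧
          (∀ y τ, (∀ j, j ≤ k → ¬ SideTouches (Ω j) y τ) → A' y τ = 0) ∧
          msup L k η (-(1 : ℝ)) (fun j (b : Site d × Fin d) => SideTouches (Ω j) b.1 b.2) (fun b => A' b.1 b.2)
              ≤ 5 * d * L * B₀ * (α₀ + α₁) ∧
          msup L k η (-(2 : ℝ)) (fun j (t : Fin d × Fin d × Site d) => SideTouches (Ω j) t.2.2 t.2.1)
              (fun t => covDerivFwd η U₀ t.1 (fun z => A' z t.2.1) t.2.2) ≤ 5 * d * L * B₀ * (α₀ + α₁) ∧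
          bondNorm L k η (-(3 : ℝ)) Ω (fun x μ => pdiv η U₀ (plaqCovDeriv η U₀ A') μ x) ≤ 5 * d * L * B₀ * (α₀ + α₁) ∧
      Lp A' ≤ 5 * d * L * B₀ * (α₀ + α₁) ∧
          Hol A' ≤ 5 * d * L * B₀β * (α₀ + α₁) := by
  have hL1 : 1 ≤ L := le_trans (by norm_num) hL
  have hcstar : 0 ≤ cstar := by rw [hc]; positivity
  -- THEOREM 4's existence clause at the last level `m = k`
  obtain ⟨u, hu, h129, W, hW, hLan, A, hA⟩ := thm4_exists_all_levels_of_b9 hd2 hη hL k hU₀ hU' hα₀ hα₁ hα₄ hB₀ hc hs₁ hs₂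
    ha ha2 hα3 hα4 h16 hd5 hsmall hc₃ hside h50 hC₂ h61 Ω hΩ Λs Λb hbox h33 h34 h66 Lan hP5base hP5 H42 H59 k le_rfl
  have hLanK : Lan k W := hLan hk
  -- the exponent field of the final gauge-fixed field (§1)
  have hWu : ∀ x κ, W x κ ∈ unitaryUnits 𝔸 := mem_unitaryUnits_of_mgauge_eq hU₀ hU' hu hW
  have hWA : ∀ j, j ≤ k → ∀ y τ, SideTouches (Ω j) y τ →
      W y τ = cfgExp η A y τ ∧ ‖A y τ‖ ≤ cstar * ((L : ℝ) ^ j * η)⁻¹ := by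
    intro j hj y τ hs
    obtain ⟨h1, -, h3⟩ := hA j hj (y, τ) hs
    exact ⟨h1, h3⟩
  obtain ⟨A', hA'sa, hA'sock, hA'0⟩ := exists_maskedLogField hη hL1 k U₀ hWu hcstar h16' Ω hWA
  have hA'41 : ∀ j, j ≤ k → ∀ y τ, SideTouches (Ω j) y τ →
      W y τ = cfgExp η A' y τ ∧ ‖A' y τ‖ ≤ cstar * ((L : ℝ) ^ j * η)⁻¹ := by
    intro j hj y τ hs
    obtain ⟨hAA, hWe⟩ := hA'sock j hj y τ hs
    exact ⟨hWe, by rw [hAA]; exact (hWA j hj y τ hs).2⟩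
  -- PROPOSITION 3 for the final field, all members (§2)
  have hn := thm2_norms_gaugeFixed_kLevel hd2 hη hL k hU₀ hα₀ hα₁ hB₀ hB₀β hc hα3 hα4 h16' hd5' hsmall' hc₃' hside' h50'
    hC₂ h61' Ω Λs Λb (hbox k le_rfl) h33 h34 Lan Lp Hol H42' H59full hu hW h129 hLanK hA'sa hA'41 hA'0
  exact ⟨u, hu, h129, W, hW, hLanK, A', hA'sa, hA'41, hA'0, hn⟩

end Main

#print axioms thm2_norms_gaugeFixed_kLevel
#print axioms thm2_exists_gaugeFixed_kLevel

end Literature.MathematicalPhysics.QuantumFieldTheory.Balaban1983to89.B8Thm2GaugeFixedKLevel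

end
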